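import Summits.FinalStateConjecture.FinalStateConjecture.Theorems.DerivativeThriftThriftyClusterSettlingOuterFlatnessForced
import HarnessLib

/-!
# Route DerivativeThrift — crux `ThriftyClusterSettling` (stmt-FinalStateConjecture-17611), negative side:
# the filed text fails as soon as ONE thrifty MGHD is not outer-flat (negative lemma modulo `H`)

`Theses.DerivativeThrift.ThriftyClusterSettling` (route file rev 2) is
`ThriftyKerrStability → ∀ admissible D, ∀ MGHD 𝒟, complete 𝓘⁺ → FullHandoff 𝒟 → ∃ O d, sub-extremal ∧
O = exteriorOf 𝒟 d.charted ∧ HasExhaustiveCharts d ∧ IsFutureOriented d`.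
By `Theorems.DerivativeThrift.ThriftyClusterSettling.outerFlatness_of_settles`
(`Theorems/DerivativeThriftThriftyClusterSettlingOuterFlatnessForced.lean`) the consequent contains an
OUTER-ZONE FLATNESS certificate: a late flat chart on an open set containing a cone complement
`{x⁰ > τₑ, |x̲| > (1 − θ) x⁰}`, `θ > 0`, into `J⁺(ι X)`, with full-slab `C²` deviation from `η` tending to `0`
and `∂₀` eventually future-directed.  None of the crux's hypotheses speaks about that region (the thrifty
hand-over and `ThriftyKerrStability` live in `J⁺` of hyperboloidal layers, maximality and sojourn-complete
`𝓘⁺` carry no metric information; three line-lead dossiers, `Cruxes/ThriftyClusterSettling/Lines/registered*.md`).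
Hence the kernel-checked content of the misstatement diagnosis:

* `thriftyClusterSettling_false_of_witness` (binder form): `ThriftyKerrStability` and ONE admissible datum
  with a maximal development that has complete `𝓘⁺`, a thrifty hand-over, and NO outer-zone flatness
  certificate, together refute `ThriftyClusterSettling`;
* the construction hypothesis `KerrStableNonOuterFlatThriftyMGHD` (named `H` of the negative-modulo lane:
  `ThriftyKerrStability ∧ NonOuterFlatThriftyMGHD`) and
  `ThriftyClusterSettling_false_of_KerrStableNonOuterFlatThriftyMGHD : H → ¬ ThriftyClusterSettling`.

This is a NEGATIVE LEMMA MODULO `H`, not a refutation: `¬ ThriftyClusterSettling` entails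
`ThriftyKerrStability` (item stmt-FinalStateConjecture-17610, open), and the tree constructs no maximal
vacuum Cauchy development of any non-trivial admissible datum, let alone one with the far-field focusing
content that defeats outer flatness on paper (Minkowski data plus an admissible, Bieri-small swarm of
far-field focusing packet pairs: dossier `Lines/registered-dead.md` §2(d)–(e); the weak-tail discussion of
item evidence DICTIONARY.md §8).  It certifies that the item AS FILED asserts far-exterior late-time `C²`
control of every thrifty MGHD, and it is killed verbatim by the repair the dossiers agree on (the outer
chart bound once inside the hand-over, one atlas: `Cruxes/ThriftyClusterSettling/Lines/registered.lean`,
Appendix, `ThriftyClusterSettlingRepairB`).  The route's thesis is untouched.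

Line lead `prover-line-stmt-FinalStateConjecture-17611-c3-0`, 2026-08-17.
-/

noncomputable section

-- D-0017: single-problem summit, `Summit.<S>.<S>.…` by design (cf. lakefile `weak.linter.dupNamespace`).
set_option linter.dupNamespace false

namespace Summit.FinalStateConjecture.FinalStateConjecture.Theorems.ThriftyClusterSettling.Negative

open Set Filter Topology TopologicalSpace
open scoped Manifold ContDiff ENNReal
open Literature.Geometry.Lorentzian
open Summit.FinalStateConjecture.FinalStateConjecture.Theses.DerivativeThrift
  (ThriftyClusterSettling ThriftyKerrStability)
open Summit.FinalStateConjecture.FinalStateConjecture.Theorems.DerivativeThriftThriftyHandoff (FullHandoff)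

/-- **A thrifty MGHD without outer-zone flatness** (the witness of the negative lemma): a connected,
Hausdorff, second countable smooth `3`-manifold `X`, an admissible vacuum datum `D` on it, and a maximal
vacuum Cauchy development `𝒟` of `D` with complete future null infinity (sojourn form) and a thrifty
`N`-hole hand-over (`FullHandoff 𝒟`, verbatim the antecedent of `ThriftyClusterSettling`) which admits NO
outer-zone flatness certificate: for no aperture `θ > 0`, time `τₑ`, open `V ⊇ {x⁰ > τₑ, |x̲| > (1 − θ) x⁰}`
and map `Φₑ : V → 𝒟` is `Φₑ` a late chart into `J⁺(ι X)` after `τₑ` over the Minkowski background on `V`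
with full-slab `C²` deviation `→ 0` and `∂₀` eventually pushed forward future-directed (the negation of the
skeleton's `OuterFlatness 𝒟`, unfolded).  On paper: Minkowski data plus an admissible Bieri-small swarm of
far-field focusing packet pairs (Bieri, J. Differential Geom. 86 (2010), Thm. 1, for the MGHD with complete
`𝓘⁺`; line dossier `Lines/registered-dead.md` §2).  Not constructible in the tree today. -/
def NonOuterFlatThriftyMGHD : Prop :=
  ∃ (X : Type) (_ : TopologicalSpace X) (_ : ChartedSpace E3 X) (_ : IsManifold (𝓡 3) ∞ X)
    (_ : T2Space X) (_ : SecondCountableTopology X) (_ : ConnectedSpace X) (D : InitialDataSet (𝓡 3) X)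
    (𝒟 : VacuumCauchyDevelopment D),
    D ∈ admissibleVacuumData X ∧ 𝒟.IsMaximal ∧ HasCompleteNullInfinity 𝒟.toCauchyDevelopment ∧
      FullHandoff 𝒟 ∧
      ¬ ∃ (θ τₑ : ℝ) (V : Opens E4) (Φₑ : V → 𝒟.carrier), 0 < θ ∧
          {x : E4 | τₑ < x 0 ∧ (1 - θ) * x 0 < E4.spatialNorm x} ⊆ (V : Set E4) ∧
          𝒟.toSpacetime.IsLateChart (Minkowski.backgroundOn V)
            (𝒟.metric.causalFuture 𝒟.timeOrientation (Set.range 𝒟.embed)) τₑ Φₑ ∧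
          Tendsto (fun τ ↦ 𝒟.toSpacetime.deviationCk (Minkowski.backgroundOn V) Φₑ 2 τ) atTop (𝓝 0) ∧
          ∀ᶠ τ in atTop, ∀ x ∈ (Minkowski.backgroundOn V).timeSlab τ,
            𝒟.timeOrientation.IsFutureDirected (mfderiv 𝓘(ℝ, E4) (𝓡 4) Φₑ x (E4.basisVector 0))

/-- **Binder form of the negative lemma.**  Thrifty Kerr stability and one thrifty MGHD without outer-zone
flatness refute `ThriftyClusterSettling`: feed the crux its hypothesis and the witness development; its
consequent is outer-flat by `outerFlatness_of_settles`, contradicting the witness.  DHRT arXiv:2104.08222,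
§1 (chart vocabulary); O'Neill 1983, Ch. 9 (kinematics, inside the cited theorem). [folklore] -/
theorem thriftyClusterSettling_false_of_witness (hK : ThriftyKerrStability) (hW : NonOuterFlatThriftyMGHD) :
    ¬ ThriftyClusterSettling := by
  intro h
  obtain ⟨X, _, _, _, _, _, _, D, 𝒟, hD, h𝒟, h𝓘, hF, hno⟩ := hW
  exact hno (DerivativeThrift.ThriftyClusterSettling.outerFlatness_of_settles 𝒟 (h hK X D hD 𝒟 h𝒟 h𝓘 hF))

/-- **`H` of the negative-modulo lane**: thrifty Kerr stability (item stmt-FinalStateConjecture-17610, the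
crux's own hypothesis — without it `¬ ThriftyClusterSettling` cannot follow from anything, since
`¬ (TKS → P) ⊢ TKS`) together with a thrifty MGHD without outer-zone flatness (`NonOuterFlatThriftyMGHD`).
A construction hypothesis of this file, not a literature fact. -/
def KerrStableNonOuterFlatThriftyMGHD : Prop :=
  ThriftyKerrStability ∧ NonOuterFlatThriftyMGHD

/-- **Negative lemma modulo `H`.**  `KerrStableNonOuterFlatThriftyMGHD → ¬ ThriftyClusterSettling`: the
filed crux asserts, beyond its near-zone endgame, that EVERY maximal development of admissible data with
complete `𝓘⁺` and a thrifty hand-over is outer-flat; a single exception (given its own hypothesis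
`ThriftyKerrStability`) kills it.  [folklore] -/
theorem ThriftyClusterSettling_false_of_KerrStableNonOuterFlatThriftyMGHD
    (H : KerrStableNonOuterFlatThriftyMGHD) : ¬ ThriftyClusterSettling :=
  thriftyClusterSettling_false_of_witness H.1 H.2

end Summit.FinalStateConjecture.FinalStateConjecture.Theorems.ThriftyClusterSettling.Negative

end
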